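import Literature.MathematicalPhysics.QuantumFieldTheory.Balaban1983to89.B9SectBL2DictionaryY
import Literature.MathematicalPhysics.QuantumFieldTheory.Balaban1983to89.B9Eq370LetterConversionL2
import Literature.MathematicalPhysics.QuantumFieldTheory.Balaban1983to89.B9SectBGpTransferConvY

/-!
# `Balaban1983to89.B9SectBL2TransferConvY` — THE `L²` LETTER CONVERSION OF THE OUTPUT TRANSFER AT THE RECORD: from the augmented (3.46) block of `KSC₃` at a
# coded product `prod U a` (letters at the base `U`) to NODE 00's (3.46) members AT `W = e^{ηa}·U` WITH LETTERS AT `W` — the members with at most one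
# difference on each side PROVED, the two same-side second-difference members LOCATED (they need the plaquette of the base `U`)

T. Bałaban, *Propagators for lattice gauge theories in a background field*, Commun. Math. Phys. **99** (1985) 389–434
[`Balaban1985BackgroundPropagators`, "B9"]; [4] = T. Bałaban, *Propagators and renormalization transformations for lattice gauge
theories. II*, Commun. Math. Phys. **96** (1984) 223–250 [`Balaban1984PropagatorsII`].

statement-level skeleton of published theorems with citation tags; proofs where landed; nothing here is a claim about the
Yang–Mills mass gap

THE PRINTED LOCI.  Theorem 3.1 (3.46) p. 398 (verbatim, lit-balaban-r06's page image): *"‖hG′(U)λ‖, ‖h∇_UG′(U)λ‖, ‖hG′(U)∇*_Uλ‖, ‖h∇_U∇_UG′(U)λ‖,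
‖h∇_UG′(U)∇*_Uλ‖, ‖hG′(U)∇*_U∇*_Uλ‖ ≤ B₀[(Lʲη)², Lʲη, Lʲη, 1, 1, 1]|h|e^{−δ₀d(y,y′)}‖λ‖"*; p. 403 l.1–9 («… for the operator G′(U′U), of course with
different constants»); (3.70) p. 404, (3.74) p. 405 (the letters at `U′U`); [4] Prop. 2.6 (2.140)–(2.141) p. 247, Lemma 2.1 p. 234.

WHY THIS FILE (pub-ymgap N06 row 13, seat dag-n06-c gen 9; the (O4) architecture).  `B9SectBL2DictionaryY` inhabits the `L²` frame over the coded carrier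
at the augmented readings `KSC₃`, whose (3.46) member at a product reads the six words with letters at the BASE `U`; the record's family
`Node00.kernelFamilyS` reads them at `W` itself.  The transfer's `hout` therefore needs, member by member, «augmented block at `prod U a` ⟹ record's
member at `W`» — the `L²` twin of gen 8's `B9SectBGpTransferConvY.hconv_at`.  THIS FILE:
* §1 `swap34`, ★ `kernelFamilyS_l2_le_l2AugS` (the record's six members are among the augmented words at `(W, W)`: member `n` ≦ augmented member
  `swap34 n` — print's 4th∕5th quantities are the frames' members 3∕4 in the other order), ★ `l2Block_kernelFamilyS_of_hasL2Majorant_wordL` (WRITE at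
  `W`: block-`ℓ²` majorants of all six `W`-words ⟹ the record's (3.46) block at `W`, constant `c_L·B`).
* §2 ★★ `hconvL2_words_at` — at ONE member above the thresholds, (2.61) and the three scale transfers at `(δ₀, 1/12)` given: the (3.46) block of `KSC₃` at
  `prod U a` ⟹ block-`ℓ²` majorants AT RATE `δ₀/2` of the `W`-words with at most one difference on each side — `G′(W)`, `∇♯_{W,k}G′(W)`, `G′(W)∇♯_{W,k}`,
  `∇♯_{W,k}G′(W)∇♯_{W,l}` (all `k, l ∈ κ ⊕ κ`) — by READ (`B9SectBL2DictionaryY.hasL2Majorant_wordL_of_l2AugS`) → CONVERT (`B9Eq370LetterConversionL2`: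
  LEFT ∕ RIGHT, the mixed member by RIGHT∘RIGHT∘LEFT) with EXPLICIT constants.
* §3 ★★ `l2Block_record_at_W_of_KSC₃` — the record's (3.46) block at `W` from the `KSC₃` block at the product AND two DISPLAYED hypotheses: the block-`ℓ²`
  majorants of the same-side second-difference `W`-words `∇♯_{W,k}∇♯_{W,l}G′(W)` and `G′(W)∇♯_{W,k}∇♯_{W,l}` (print's 4th and 6th quantities at `W`).

HONEST SCOPE ∕ LOCATED.  The two displayed hypotheses of §3 are NOT bookkeeping: converting `∇_{U,k}∇_{U,l}G′(W)` (available) into `∇_{W,k}∇_{W,l}G′(W)` makes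
the commutator `[∇_{U,k}, τ_{U,l}]` of the base appear for `k ≠ l`, i.e. the PLAQUETTE `U(∂p) − 1` of the (3.35)-regular base `U` (size `O(1)Mα₀(Lʲη)⁻²η²` on
the cubes of the p. 396 class) — print STATES it, p. 404 under (3.69): «the estimates |Re(U′U)(∂p) − 1|, |Im(U′U)(∂p)| ≤ O(1)(Mα₀ + α₁)ξ², ξ = L⁻ʲ …
follow directly from the assumptions (3.35), (3.37)» (lit-balaban desk ME #36, 2026-08-28), but it is not yet typed in the tree (the two-line derivation from
(3.35) by gauge covariance of the holonomy is the successor's, as a displayed letter law).  Everything proved here is finite-dimensional operator algebra over NODE 00's DEFINED readings with every constant explicit; nothing of Theorem 3.1 ∕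
3.4 is asserted (the `KSC₃` block at the product is the HYPOTHESIS — it is what the `L²` frame writes); per-member section `ιB` of `β` (`hι`, corner-free
members).  COUNT-NEUTRAL; N06 NOT discharged; one finite lattice programme — nothing continuum ∕ OS ∕ mass-gap ∕ Clay.  Cell `pub-ymgap` (HUMAN RULING D-0062),
Track A node N06 [B9], row 13, 2026-08-28.

RELATED IN THE TREE, NOT DUPLICATED: `B9SectBGpTransferConvY` (gen 8: the (3.42) twin `hconv_at`, `letters337_of_cplxLettersY` — used BY NAME),
`B9SectBL2DictionaryY` (READ∕WRITE, `KSC₃`, `wordL`), `B9Eq370LetterConversionL2` (CONVERT), `B9SectBL2ReadingsY`, `Node00.OpsYRead342` (`UboxY_mulY_fluct`).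
-/

noncomputable section

namespace Literature.MathematicalPhysics.QuantumFieldTheory.Balaban1983to89.B9SectBL2TransferConvY

open Literature.MathematicalPhysics.QuantumFieldTheory.Balaban1983to89
open Literature.MathematicalPhysics.QuantumFieldTheory.Balaban1983to89.B6KLevelCensusIndexV1 (KIdx kGeo)
open Literature.MathematicalPhysics.QuantumFieldTheory.Balaban1983to89.B6Ineq2142KLevelV1 (β)
open Literature.MathematicalPhysics.QuantumFieldTheory.Balaban1983to89.B6RandomWalk (Triangle254 Ineq261)
open Literature.MathematicalPhysics.QuantumFieldTheory.Balaban1983to89.B6RandomWalkL2 (HasL2Majorant hasL2Majorant_mono)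
open Literature.MathematicalPhysics.QuantumFieldTheory.Balaban1983to89.B9Thm34Ext (toB6)
open Literature.MathematicalPhysics.QuantumFieldTheory.Balaban1983to89.B9Ineq347 (ScaleTransfer)
open Literature.MathematicalPhysics.QuantumFieldTheory.Balaban1983to89.B9FromB6 (L2Block pref6_nonneg)
open Literature.MathematicalPhysics.QuantumFieldTheory.Balaban1983to89.B9Eq39Adjoint (fluct prodCfg)
open Literature.MathematicalPhysics.QuantumFieldTheory.Balaban1983to89.B9Eq352DivFormLetters (conj)
open Literature.MathematicalPhysics.QuantumFieldTheory.Balaban1983to89.B9Eq352GradLetters (diffLetter)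
open Literature.MathematicalPhysics.QuantumFieldTheory.Balaban1983to89.B9SectBCodedCarrier (CCfg)
open Literature.MathematicalPhysics.QuantumFieldTheory.Balaban1983to89.B9Eq360DeltaPrimeAY (AfldY mulY chartA UboxY_mulY_fluct)
open Literature.MathematicalPhysics.QuantumFieldTheory.Balaban1983to89.B9PinMembersKLevelV1 (MemberY geo9Y bg9Y)
open Literature.MathematicalPhysics.QuantumFieldTheory.Balaban1983to89.B9SectBGpLettersY (decY GVal coordC blkC GopC stencilF_blkC stencilB_blkC
  norm_le_one_and_inv_of_mem)
open Literature.MathematicalPhysics.QuantumFieldTheory.Balaban1983to89.B9SectBGpFrameCodedY (codingYx CplxLettersY)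
open Literature.MathematicalPhysics.QuantumFieldTheory.Balaban1983to89.B9SectBGpReadingsY (baseY etaS_eq_eta)
open Literature.MathematicalPhysics.QuantumFieldTheory.Balaban1983to89.B9SectBL2DictionaryY (wordSL wordL e6 l2LatSC l2AugS l2AugS_inl KSC₃ KSC₃_l2
  exists_ball_bound_l2LatSC hasL2Majorant_wordL_of_l2AugS l2AugS_le_of_hasL2Majorant_wordL coordC_base_eq dirS)
open Literature.MathematicalPhysics.QuantumFieldTheory.Balaban1983to89.B9Eq370LetterConversionL2 (hasL2Majorant_diffLetter_prodCfg_mul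
  hasL2Majorant_mul_diffLetter_prodCfg)
open Literature.MathematicalPhysics.QuantumFieldTheory.Balaban1983to89.B9SectBGpTransferConvY (letters337_of_cplxLettersY)
open Literature.MathematicalPhysics.QuantumFieldTheory.Balaban1983to89.B9Ineq363L2 (hasL2Majorant_rate_mono)
open Literature.MathematicalPhysics.QuantumFieldTheory.Balaban1983to89.B9GeoLemma21KLevelV1 (geo9Y_dist_self geo9Y_dist_comm geo9Y_dist_triangle geo9Y_len_pos
  geo9K_eta_pos geo9K_one_le_L)
open Literature.MathematicalPhysics.QuantumFieldTheory.Balaban1983to89.B9RWSums347DefiniteFacesWindow (geo9Y_dist_nonneg)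
open Literature.MathematicalPhysics.QuantumFieldTheory.Balaban1983to89.B9Thm314WholeExpansionReads (le_iSup_ball)
open Literature.MathematicalPhysics.QuantumFieldTheory.Balaban1983to89.Node00 (SiteY BlkY IBondY CfgY BallY SiteOpY SiteParY UboxY shiftY cdS cdsS
  liftY l2OfY etaS kernelFamilyS GpY)

variable {𝔸 : Type} [NormedRing 𝔸] [NormedAlgebra ℂ 𝔸] [CompleteSpace 𝔸] [FiniteDimensional ℝ 𝔸]
variable {d ℓ : ℕ} {hd : 1 ≤ d + 1} {hL : Odd (ℓ + 1) ∧ 1 < ℓ + 1} {b₀ b₁ : ℝ} {Mstar : ℕ}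

/-! ## §1 The record's six members are among the augmented words at `(W, W)`; ★ WRITE at `W` -/

section Record

variable (x : MemberY d ℓ hd hL b₀ b₁ Mstar) (ιB : BlkY x.toKIdx → IBondY x.toKIdx) {ι : Type} [Fintype ι] (b : Module.Basis ι ℝ 𝔸)
  [Fintype (geo9Y x).Site] [DecidableEq (geo9Y x).Site]

/-- the index dictionary between NODE 00's (3.46) members and the frames' words: the record's member 3 (`∇G∇*`, print's 5th quantity) is the mixed word 4, its
member 4 (`∇∇G`, print's 4th) is the left second-difference word 3; the others agree. [cite: Balaban1985BackgroundPropagators, (3.46) p.398, bookkeeping] -/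
def swap34 : Fin 6 → Fin 6 := ![0, 1, 2, 4, 3, 5]

omit [NormedRing 𝔸] [NormedAlgebra ℂ 𝔸] [CompleteSpace 𝔸] [FiniteDimensional ℝ 𝔸] in
/-- the prefactors of (3.46) are invariant under the index dictionary. [cite: Balaban1985BackgroundPropagators, (3.46) p.398, bookkeeping] -/
theorem pref6_swap34 (t : ℝ) (n : Fin 6) : B9.pref6 t (swap34 n) = B9.pref6 t n := by
  match n with
  | 0 => rfl
  | 1 => rfl
  | 2 => rfl
  | 3 => rfl
  | 4 => rfl
  | 5 => rfl

omit [Fintype (geo9Y x).Site] [DecidableEq (geo9Y x).Site] in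
/-- ★ **THE RECORD'S SIX (3.46) MEMBERS ARE AMONG THE AUGMENTED WORDS**: for NODE 00's reading `kernelFamilyS i B cfg O par` at any configuration `c`
(letters and operator both at `V = cfg c`), member `n` is bounded by the augmented member `swap34 n` of `B9SectBL2DictionaryY.l2AugS` at the base-coded
decoding `c ↦ base (cfg c)` (each of print's six words is one of the signed words).
[cite: Balaban1985BackgroundPropagators, Thm 3.1 (3.46) p.398, p.398 (first remark after Thm 3.1)] -/
theorem kernelFamilyS_l2_le_l2AugS {B : B9.Backgrounds} (cfg : B.Cfg → CfgY 𝔸 x.toKIdx) (O : SiteOpY 𝔸 x.toKIdx) (par : SiteParY 𝔸 x.toKIdx)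
    (n : Fin 6) (c : B.Cfg) (lam : (geo9Y x).Loc) (h : (geo9Y x).Cut) :
    (kernelFamilyS x.toKIdx B cfg O par).l2 n c lam h ≤ l2AugS x.toKIdx (B := B) (fun c => CCfg.base (cfg c)) O (swap34 n) c lam h := by
  have hη0 : 0 ≤ etaS x.toKIdx := by rw [etaS_eq_eta]; exact (geo9K_eta_pos x.toKIdx).le
  match lam, h with
  | .inr _, .inl _ => exact le_rfl
  | .inr _, .inr _ => exact le_rfl
  | .inl _, .inr _ => exact le_rfl
  | .inl f, .inl hh =>
    set V := cfg c with hV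
    have hbdd : ∀ m : Fin 6, BddAbove (Set.range fun E : BallY 𝔸 => l2LatSC x.toKIdx O V V (liftY f (E : 𝔸)) hh m) := fun m => by
      obtain ⟨C, hC⟩ := exists_ball_bound_l2LatSC x O V V f hh m
      exact ⟨C, by rintro _ ⟨E, rfl⟩; exact hC E⟩
    -- every word of the record at direction(s) `(μ, ν)` is the signed word at `(inl∕inr μ, inl∕inr ν)`, hence below the augmented entry
    have hw' : ∀ (E : BallY 𝔸) (k l : Fin (d + 1) ⊕ Fin (d + 1)) (m : Fin 6),
        l2OfY hh (wordSL x.toKIdx O V V m k l (liftY f (E : 𝔸))) ≤ l2LatSC x.toKIdx O V V (liftY f (E : 𝔸)) hh m := fun E k l m =>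
      le_ciSup (f := fun q : (Fin (d + 1) ⊕ Fin (d + 1)) × (Fin (d + 1) ⊕ Fin (d + 1)) => l2OfY hh (wordSL x.toKIdx O V V m q.1 q.2 (liftY f (E : 𝔸))))
        (Set.finite_range _).bddAbove (k, l)
    have hWd := fun (E : BallY 𝔸) k l => B9SectBL2DictionaryY.wordSL_apply x.toKIdx O V V k l (liftY f (E : 𝔸))
    have hD := fun μ => B9SectBL2DictionaryY.dirS_inl_inr (𝔸 := 𝔸) x.toKIdx V μ
    have fin : ∀ (e : ℕ) {A B : BallY 𝔸 → ℝ} (m : Fin 6), (B = fun E : BallY 𝔸 => l2LatSC x.toKIdx O V V (liftY f (E : 𝔸)) hh m) → (∀ E, A E ≤ B E) →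
        etaS x.toKIdx ^ e * (⨆ E, A E) ≤ etaS x.toKIdx ^ e * ⨆ E, B E := by
      intro e A B m hB hAB
      subst hB
      exact mul_le_mul_of_nonneg_left (ciSup_mono (hbdd m) hAB) (pow_nonneg hη0 _)
    match n with
    | 0 =>
      show etaS x.toKIdx ^ 2 * (⨆ E : BallY 𝔸, l2OfY hh (O V (liftY f (E : 𝔸)))) ≤ etaS x.toKIdx ^ 2 * ⨆ E : BallY 𝔸, l2LatSC x.toKIdx O V V (liftY f (E : 𝔸)) hh 0
      refine fin 2 0 rfl fun E => ?_
      have h := hw' E (Sum.inl 0) (Sum.inl 0) 0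
      rwa [(hWd E _ _).1] at h
    | 1 =>
      show etaS x.toKIdx ^ 1 * (⨆ E : BallY 𝔸, ⨆ μ : Fin (d + 1), l2OfY hh (cdS x.toKIdx V μ (O V (liftY f (E : 𝔸))))) ≤
        etaS x.toKIdx ^ 1 * ⨆ E : BallY 𝔸, l2LatSC x.toKIdx O V V (liftY f (E : 𝔸)) hh 1
      refine fin 1 1 rfl fun E => ciSup_le fun μ => ?_
      have h := hw' E (Sum.inl μ) (Sum.inl 0) 1
      rwa [(hWd E _ _).2.1, (hD μ (O V (liftY f (E : 𝔸)))).1] at h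
    | 2 =>
      show etaS x.toKIdx ^ 1 * (⨆ E : BallY 𝔸, ⨆ μ : Fin (d + 1), l2OfY hh (O V (cdsS x.toKIdx V μ (liftY f (E : 𝔸))))) ≤
        etaS x.toKIdx ^ 1 * ⨆ E : BallY 𝔸, l2LatSC x.toKIdx O V V (liftY f (E : 𝔸)) hh 2
      refine fin 1 2 rfl fun E => ciSup_le fun μ => ?_
      have h := hw' E (Sum.inr μ) (Sum.inl 0) 2
      rwa [(hWd E _ _).2.2.1, (hD μ (liftY f (E : 𝔸))).2] at h
    | 3 =>
      show etaS x.toKIdx ^ 0 * (⨆ E : BallY 𝔸, ⨆ μ : Fin (d + 1), ⨆ ν : Fin (d + 1), l2OfY hh (cdS x.toKIdx V μ (O V (cdsS x.toKIdx V ν (liftY f (E : 𝔸)))))) ≤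
        etaS x.toKIdx ^ 0 * ⨆ E : BallY 𝔸, l2LatSC x.toKIdx O V V (liftY f (E : 𝔸)) hh 4
      refine fin 0 4 rfl fun E => ciSup_le fun μ => ciSup_le fun ν => ?_
      have h := hw' E (Sum.inl μ) (Sum.inr ν) 4
      rwa [(hWd E _ _).2.2.2.2.1, (hD ν (liftY f (E : 𝔸))).2, (hD μ (O V (cdsS x.toKIdx V ν (liftY f (E : 𝔸))))).1] at h
    | 4 =>
      show etaS x.toKIdx ^ 0 * (⨆ E : BallY 𝔸, ⨆ μ : Fin (d + 1), ⨆ ν : Fin (d + 1), l2OfY hh (cdS x.toKIdx V μ (cdS x.toKIdx V ν (O V (liftY f (E : 𝔸)))))) ≤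
        etaS x.toKIdx ^ 0 * ⨆ E : BallY 𝔸, l2LatSC x.toKIdx O V V (liftY f (E : 𝔸)) hh 3
      refine fin 0 3 rfl fun E => ciSup_le fun μ => ciSup_le fun ν => ?_
      have h := hw' E (Sum.inl μ) (Sum.inl ν) 3
      rwa [(hWd E _ _).2.2.2.1, (hD ν (O V (liftY f (E : 𝔸)))).1, (hD μ (cdS x.toKIdx V ν (O V (liftY f (E : 𝔸))))).1] at h
    | 5 =>
      show etaS x.toKIdx ^ 0 * (⨆ E : BallY 𝔸, ⨆ μ : Fin (d + 1), ⨆ ν : Fin (d + 1), l2OfY hh (O V (cdsS x.toKIdx V μ (cdsS x.toKIdx V ν (liftY f (E : 𝔸)))))) ≤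
        etaS x.toKIdx ^ 0 * ⨆ E : BallY 𝔸, l2LatSC x.toKIdx O V V (liftY f (E : 𝔸)) hh 5
      refine fin 0 5 rfl fun E => ciSup_le fun μ => ciSup_le fun ν => ?_
      have h := hw' E (Sum.inr μ) (Sum.inr ν) 5
      rwa [(hWd E _ _).2.2.2.2.2, (hD ν (liftY f (E : 𝔸))).2, (hD μ (cdsS x.toKIdx V ν (liftY f (E : 𝔸)))).2] at h

/-- ★ **WRITE AT `W` INTO THE RECORD**: at a member with a section `ιB` of `β`, block-`ℓ²` majorants `B·pref6_n(ℓ(a))·e^{−δd}` (`B ≧ 0`) of ALL six `W`-words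
`conj b (wordL O W W η n k l)` (letters and operator at the same configuration `W`) give the (3.46) block of NODE 00's reading `kernelFamilyS … id O par` at `W`
with `(c_L·B, δ)`, `c_L = √|ι|·M₂·Σ_j‖b_j‖`. [cite: Balaban1985BackgroundPropagators, Thm 3.1 (3.46) p.398, Thm 3.4 p.400; Balaban1984PropagatorsII, Prop. 2.6 (2.140) p.247] -/
theorem l2Block_kernelFamilyS_of_hasL2Majorant_wordL (hι : ∀ s : BlkY x.toKIdx, β x.toKIdx.hN x.toKIdx.D x.toKIdx.hk (ιB s) = s)
    {M₂ : ℝ} (hM₂ : 0 ≤ M₂) (hrepr : ∀ (v : 𝔸) (j : ι), |b.repr v j| ≤ M₂ * ‖v‖) (R : ℝ) (H : Prop)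
    {B : B9.Backgrounds} (cfg : B.Cfg → CfgY 𝔸 x.toKIdx) (O : SiteOpY 𝔸 x.toKIdx) (par : SiteParY 𝔸 x.toKIdx) {B' δ : ℝ} (hB' : 0 ≤ B') {c : B.Cfg}
    (hW : ∀ (n : Fin 6) (k l : Fin (d + 1) ⊕ Fin (d + 1)), HasL2Majorant (g := toB6 (geo9Y x) R H) (fun p : SiteY x.toKIdx × ι => blkC x.toKIdx ιB p.1)
      (conj b (wordL x.toKIdx O (cfg c) (cfg c) (kGeo x.toKIdx).eta n k l))
      (fun a a' => B' * B9.pref6 ((geo9Y x).len a) n * Real.exp (-(δ * (geo9Y x).dist a a')))) :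
    L2Block (kernelFamilyS x.toKIdx B cfg O par) ((Real.sqrt (Fintype.card ι) * M₂ * ∑ j, ‖b j‖) * B') δ c := by
  intro n lam h y y' hcut hsupp
  refine (kernelFamilyS_l2_le_l2AugS x cfg O par n c lam h).trans ?_
  have hw := l2AugS_le_of_hasL2Majorant_wordL x ιB b hι hM₂ hrepr R H (B := B) (fun c => CCfg.base (cfg c)) O hB' (c := c) (swap34 n)
    (fun k l => hW (swap34 n) k l) lam h y y' hcut hsupp
  rw [pref6_swap34] at hw
  exact hw

end Record

/-! ## §2 ★★ The conversion at one member: the `W`-words with at most one difference on each side -/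

section Member

variable (G : Subgroup 𝔸ˣ) (x : MemberY d ℓ hd hL b₀ b₁ Mstar) (par : SiteParY 𝔸 x.toKIdx) {ι : Type} [Fintype ι] [DecidableEq ι]
  (b : Module.Basis ι ℝ 𝔸) (ιB : BlkY x.toKIdx → IBondY x.toKIdx) [Fintype (geo9Y x).Site] [DecidableEq (geo9Y x).Site]
  (C37 C38 : ℝ → CfgY 𝔸 x.toKIdx → AfldY 𝔸 x.toKIdx → Prop)

/-- the defect constant `c_D(r) = 4·M₂(Σ‖b_j‖)·√|ι|·e^{r·2(d+1)}` of `B9Eq370LetterConversionL2` at unit transports and NODE 00's stencil range `2(d+1)`.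
[cite: Balaban1985BackgroundPropagators, (3.70) p.404, (3.74) p.405, bookkeeping] -/
def cDef (M₂ Sb sι : ℝ) (d : ℕ) (r : ℝ) : ℝ := 4 * (1 : ℝ) ^ 2 * M₂ * Sb * sι * Real.exp (r * (2 * ((d : ℝ) + 1)))

/-- ★ **THE EXPLICIT CONSTANT OF THE `L²` CONVERSION** (member-independent): with `B_in = c_L·B₀` (`c_L = √|ι|·M₂·Σ‖b_j‖` the reading constant),
`c₁ = c₁(dL, δ₀, 1/12)`, `g(r) = 1 + c_D(r)·(1/4)·Λ·c₁`: the maximum of the converted constants of the four word families (`B_in`, `g(δ₀)B_in`, `g(5δ₀/6)B_in`,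
`g(5δ₀/6)·g(5δ₀/6)·B_in` for the mixed member). [cite: Balaban1985BackgroundPropagators, p.403 l.1–9 («of course with different constants»), bookkeeping] -/
def convConstL2 (M₂ Sb sι : ℝ) (d dL : ℕ) (δ₀ Λ B₀ : ℝ) : ℝ :=
  (1 + cDef M₂ Sb sι d δ₀ * (1 / 4) * Λ * B6.c1 dL δ₀ (1 / 12)) * (1 + cDef M₂ Sb sι d (5 * δ₀ / 6) * (1 / 4) * Λ * B6.c1 dL δ₀ (1 / 12)) *
    ((sι * M₂ * Sb) * B₀)

omit [NormedRing 𝔸] [NormedAlgebra ℂ 𝔸] [CompleteSpace 𝔸] [FiniteDimensional ℝ 𝔸] in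
/-- `c_D(r) ≧ 0` for `M₂, Sb, sι ≧ 0`. [cite: Balaban1985BackgroundPropagators, (3.70) p.404, bookkeeping] -/
theorem cDef_nonneg {M₂ Sb sι : ℝ} (hM₂ : 0 ≤ M₂) (hSb : 0 ≤ Sb) (hsι : 0 ≤ sι) (d : ℕ) (r : ℝ) : 0 ≤ cDef M₂ Sb sι d r := by
  unfold cDef; positivity

/-- ★★ **THE `L²` LETTER CONVERSION AT ONE MEMBER, THE WORDS WITH AT MOST ONE DIFFERENCE ON EACH SIDE.**  Data as in gen 8's `hconv_at`: unit-norm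
structure group, a section `ιB` of `β`, a real basis with coordinate constant `M₂`, the coded-class dictionary `hC37`; Lemma 2.1 of [4] at `(δ₀, 1/12)`
with exponent `dL`, the scale transfers of `ℓ, ℓ², ℓ⁻¹` at `(δ₀, 1/12)` with constant `Λ ≧ 0`.  Then for `(U, a)` in the coded class at `α₁ ≦ 1/4` and
`B₀ ≧ 0`, the (3.46) block of `KSC₃` at `prod U a` (letters at `U`) gives, AT `W = e^{ηa}·U` WITH LETTERS AT `W` and rate `δ₀/2`, the block-`ℓ²` majorants
of `conj b (η²G′(W))` (weight `ℓ²`), of every `conj b (∇♯_{W,k}-letter)·conj b (η²G′(W))` and `conj b (η²G′(W))·conj b (∇♯_{W,k}-letter)` (weight `ℓ`), and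
of every `conj b (∇♯_{W,k})·conj b (η²G′(W))·conj b (∇♯_{W,l})` (weight `1`), all with the constant `convConstL2 …`.
[cite: Balaban1985BackgroundPropagators, p.403 l.1–9, (3.70) p.404, (3.74) p.405, Thm 3.1 (3.46) p.398, (3.37) p.396; Balaban1984PropagatorsII, Prop. 2.6 (2.140)–(2.141) p.247, Lemma 2.1 p.234] -/
theorem hconvL2_words_at (hι : ∀ s : BlkY x.toKIdx, β x.toKIdx.hN x.toKIdx.D x.toKIdx.hk (ιB s) = s)
    (hG1 : ∀ u : 𝔸ˣ, u ∈ G → ‖(u : 𝔸)‖ ≤ 1) {M₂ : ℝ} (hM₂ : 0 ≤ M₂) (hrepr : ∀ (v : 𝔸) (j : ι), |b.repr v j| ≤ M₂ * ‖v‖)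
    {Cq : ℝ} (hC37 : ∀ β' U a, C37 β' U a → GVal G x.toKIdx U ∧ CplxLettersY G x par ιB Cq β' U a)
    {δ₀ : ℝ} (hδ₀ : 0 < δ₀) {dL : ℕ} (h261 : Ineq261 dL (toB6 (geo9Y x) (0 : ℝ) True) δ₀ (1 / 12)) {Λ : ℝ} (hΛ : 0 ≤ Λ)
    (hT1 : ScaleTransfer (geo9Y x) δ₀ (1 / 12) Λ (fun a => (geo9Y x).len a))
    (hT2 : ScaleTransfer (geo9Y x) δ₀ (1 / 12) Λ (fun a => (geo9Y x).len a ^ 2))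
    (hTi : ScaleTransfer (geo9Y x) δ₀ (1 / 12) Λ (fun a => ((geo9Y x).len a)⁻¹))
    {B₀ : ℝ} (hB₀ : 0 ≤ B₀) {U : CfgY 𝔸 x.toKIdx} {a : AfldY 𝔸 x.toKIdx} {α₁ : ℝ} (hα₁c : α₁ ≤ 1 / 4) (hC : C37 α₁ U a)
    (hL2 : L2Block (KSC₃ G x par C37 C38) B₀ δ₀ (.prod U a)) :
    HasL2Majorant (g := toB6 (geo9Y x) (0 : ℝ) True) (fun p : SiteY x.toKIdx × ι => blkC x.toKIdx ιB p.1)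
        (conj b (((kGeo x.toKIdx).eta ^ 2) • (GpY x.toKIdx par (mulY x.toKIdx (fluct (kGeo x.toKIdx).eta a) U)).restrictScalars ℝ))
        (fun p q => convConstL2 M₂ (∑ j, ‖b j‖) (Real.sqrt (Fintype.card ι)) d dL δ₀ Λ B₀ * (geo9Y x).len p ^ 2 * Real.exp (-(δ₀ / 2 * (geo9Y x).dist p q))) ∧
      (∀ k : Fin (d + 1) ⊕ Fin (d + 1), HasL2Majorant (g := toB6 (geo9Y x) (0 : ℝ) True) (fun p : SiteY x.toKIdx × ι => blkC x.toKIdx ιB p.1)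
        (conj b (diffLetter (shiftY x.toKIdx) (UboxY x.toKIdx (mulY x.toKIdx (fluct (kGeo x.toKIdx).eta a) U)) ((((kGeo x.toKIdx).eta : ℂ))⁻¹) k) * conj b (((kGeo x.toKIdx).eta ^ 2) • (GpY x.toKIdx par (mulY x.toKIdx (fluct (kGeo x.toKIdx).eta a) U)).restrictScalars ℝ))
        (fun p q => convConstL2 M₂ (∑ j, ‖b j‖) (Real.sqrt (Fintype.card ι)) d dL δ₀ Λ B₀ * (geo9Y x).len p * Real.exp (-(δ₀ / 2 * (geo9Y x).dist p q)))) ∧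
      (∀ k : Fin (d + 1) ⊕ Fin (d + 1), HasL2Majorant (g := toB6 (geo9Y x) (0 : ℝ) True) (fun p : SiteY x.toKIdx × ι => blkC x.toKIdx ιB p.1)
        (conj b (((kGeo x.toKIdx).eta ^ 2) • (GpY x.toKIdx par (mulY x.toKIdx (fluct (kGeo x.toKIdx).eta a) U)).restrictScalars ℝ) * conj b (diffLetter (shiftY x.toKIdx) (UboxY x.toKIdx (mulY x.toKIdx (fluct (kGeo x.toKIdx).eta a) U)) ((((kGeo x.toKIdx).eta : ℂ))⁻¹) k))
        (fun p q => convConstL2 M₂ (∑ j, ‖b j‖) (Real.sqrt (Fintype.card ι)) d dL δ₀ Λ B₀ * (geo9Y x).len p * Real.exp (-(δ₀ / 2 * (geo9Y x).dist p q)))) ∧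
      (∀ k l : Fin (d + 1) ⊕ Fin (d + 1), HasL2Majorant (g := toB6 (geo9Y x) (0 : ℝ) True) (fun p : SiteY x.toKIdx × ι => blkC x.toKIdx ιB p.1)
        (conj b (diffLetter (shiftY x.toKIdx) (UboxY x.toKIdx (mulY x.toKIdx (fluct (kGeo x.toKIdx).eta a) U)) ((((kGeo x.toKIdx).eta : ℂ))⁻¹) k) * conj b (((kGeo x.toKIdx).eta ^ 2) • (GpY x.toKIdx par (mulY x.toKIdx (fluct (kGeo x.toKIdx).eta a) U)).restrictScalars ℝ) *
          conj b (diffLetter (shiftY x.toKIdx) (UboxY x.toKIdx (mulY x.toKIdx (fluct (kGeo x.toKIdx).eta a) U)) ((((kGeo x.toKIdx).eta : ℂ))⁻¹) l))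
        (fun p q => convConstL2 M₂ (∑ j, ‖b j‖) (Real.sqrt (Fintype.card ι)) d dL δ₀ Λ B₀ * 1 * Real.exp (-(δ₀ / 2 * (geo9Y x).dist p q)))) := by
  -- names for the letters and constants
  set η : ℝ := (kGeo x.toKIdx).eta with hηdef
  set W : CfgY 𝔸 x.toKIdx := mulY x.toKIdx (fluct η a) U with hW
  set Bc : ℝ := convConstL2 M₂ (∑ j, ‖b j‖) (Real.sqrt (Fintype.card ι)) d dL δ₀ Λ B₀ with hBcdef
  set Sb : ℝ := ∑ j, ‖b j‖ with hSbdef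
  set sι : ℝ := Real.sqrt (Fintype.card ι) with hsι
  set cL : ℝ := sι * M₂ * Sb with hcL
  set Bin : ℝ := cL * B₀ with hBin
  set d₀ : ℝ := 2 * ((d : ℝ) + 1) with hd₀
  set c₁ : ℝ := B6.c1 dL δ₀ (1 / 12) with hc₁
  set ρ₁ : ℝ := 5 * δ₀ / 6 with hρ₁
  set ρ₂ : ℝ := 2 * δ₀ / 3 with hρ₂
  set g₀ : ℝ := 1 + cDef M₂ Sb sι d δ₀ * (1 / 4) * Λ * c₁ with hg₀
  set g₁ : ℝ := 1 + cDef M₂ Sb sι d ρ₁ * (1 / 4) * Λ * c₁ with hg₁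
  -- signs
  have hSb : 0 ≤ Sb := Finset.sum_nonneg fun j _ => norm_nonneg _
  have hsι0 : 0 ≤ sι := Real.sqrt_nonneg _
  have hcL0 : 0 ≤ cL := by positivity
  have hBin0 : 0 ≤ Bin := mul_nonneg hcL0 hB₀
  have hc₁0 : 0 ≤ c₁ := B6RandomWalk.c1_nonneg dL δ₀ (1 / 12)
  have hcD0 : 0 ≤ cDef M₂ Sb sι d δ₀ := cDef_nonneg hM₂ hSb hsι0 d δ₀
  have hcD1 : 0 ≤ cDef M₂ Sb sι d ρ₁ := cDef_nonneg hM₂ hSb hsι0 d ρ₁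
  have hg₀1 : 1 ≤ g₀ := by rw [hg₀]; exact le_add_of_nonneg_right (mul_nonneg (mul_nonneg (mul_nonneg hcD0 (by norm_num)) hΛ) hc₁0)
  have hg₁1 : 1 ≤ g₁ := by rw [hg₁]; exact le_add_of_nonneg_right (mul_nonneg (mul_nonneg (mul_nonneg hcD1 (by norm_num)) hΛ) hc₁0)
  have hg₀0 : 0 ≤ g₀ := le_trans zero_le_one hg₀1
  have hg₁0 : 0 ≤ g₁ := le_trans zero_le_one hg₁1
  have hBc : Bc = g₀ * g₁ * Bin := by rw [hBcdef, hg₀, hg₁, hBin, hcL, hc₁, hρ₁]; rfl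
  -- geometry of the member
  have hη0 : 0 < η := geo9K_eta_pos x.toKIdx
  have hdnn : ∀ y y' : (geo9Y x).Site, 0 ≤ (geo9Y x).dist y y' := geo9Y_dist_nonneg x
  have htri : Triangle254 (toB6 (geo9Y x) (0 : ℝ) True) := fun p q r => geo9Y_dist_triangle x p q r
  have hlen : ∀ y : (geo9Y x).Site, 0 < (geo9Y x).len y := geo9Y_len_pos x
  have hd₀F : ∀ (μ : Fin (d + 1)) (z : SiteY x.toKIdx), (geo9Y x).dist (blkC x.toKIdx ιB z) (blkC x.toKIdx ιB (shiftY x.toKIdx μ z)) ≤ d₀ ∧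
      (geo9Y x).dist (blkC x.toKIdx ιB z) (blkC x.toKIdx ιB ((shiftY x.toKIdx μ).symm z)) ≤ d₀ :=
    fun μ z => ⟨stencilF_blkC x.toKIdx ιB hι μ z, stencilB_blkC x.toKIdx ιB hι μ z⟩
  -- the class: `U` is `G`-valued, the (3.37) letters at `α₁ ≤ 1/4`
  obtain ⟨hU, hcl⟩ := hC37 α₁ U a hC
  obtain ⟨hA, -⟩ := letters337_of_cplxLettersY G x par ιB hα₁c hU hcl
  have hρu : ∀ (μ : Fin (d + 1)) (z : SiteY x.toKIdx), ‖((UboxY x.toKIdx U μ z : 𝔸ˣ) : 𝔸)‖ ≤ 1 ∧ ‖(((UboxY x.toKIdx U μ z)⁻¹ : 𝔸ˣ) : 𝔸)‖ ≤ 1 :=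
    fun μ z => norm_le_one_and_inv_of_mem G hG1 (hU μ _ : UboxY x.toKIdx U μ z ∈ G)
  have hsmall : ∀ y : (geo9Y x).Site, η * ((1 / 4 : ℝ) * ((geo9Y x).len y)⁻¹) ≤ 1 / 4 := by
    intro y
    have hηle : η ≤ (geo9Y x).len y := by
      show (geo9Y x).eta ≤ (geo9Y x).L ^ (geo9Y x).scale y * (geo9Y x).eta
      exact le_mul_of_one_le_left (geo9K_eta_pos x.toKIdx).le (one_le_pow₀ (geo9K_one_le_L x.toKIdx))
    have hl := hlen y
    rw [show η * ((1 / 4 : ℝ) * ((geo9Y x).len y)⁻¹) = (1 / 4) * (η / (geo9Y x).len y) by ring]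
    have : η / (geo9Y x).len y ≤ 1 := (div_le_one hl).mpr hηle
    linarith
  -- the letters
  set Gw : Module.End ℝ (SiteY x.toKIdx → 𝔸) := (η ^ 2) • (GpY x.toKIdx par W).restrictScalars ℝ with hGw
  set DU : Fin (d + 1) ⊕ Fin (d + 1) → Module.End ℝ (SiteY x.toKIdx → 𝔸) := fun k => diffLetter (shiftY x.toKIdx) (UboxY x.toKIdx U) (((η : ℂ))⁻¹) k
    with hDU
  have hUW : UboxY x.toKIdx W = prodCfg (UboxY x.toKIdx U) η (chartA x.toKIdx a) := by rw [UboxY_mulY_fluct]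
  -- READ: the words of `KSC₃` at the product, letters at `U`, rate δ₀, constant `Bin`
  have hRd := fun n k l => hasL2Majorant_wordL_of_l2AugS x ιB b hι hM₂ hrepr (0 : ℝ) True (B := (codingYx G x C37 C38).bg) (fun c => c)
    (GpY x.toKIdx par) hB₀ (c := .prod U a) n (fun lam hh y y' hc hs => hL2 n lam hh y y' hc hs) k l
  have hK : ∀ (n : Fin 6) (p q : (geo9Y x).Site), (sι * M₂ * ∑ j, ‖b j‖) * B₀ * B9.pref6 ((geo9Y x).len p) n * Real.exp (-(δ₀ * (geo9Y x).dist p q))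
      = Bin * B9.pref6 ((geo9Y x).len p) n * Real.exp (-(δ₀ * (geo9Y x).dist p q)) := fun n p q => by rw [hBin, hcL, hSbdef]
  have h0 : HasL2Majorant (g := toB6 (geo9Y x) (0 : ℝ) True) (fun p : SiteY x.toKIdx × ι => blkC x.toKIdx ιB p.1) (conj b Gw)
      (fun p q => Bin * (geo9Y x).len p ^ 2 * Real.exp (-(δ₀ * (geo9Y x).dist p q))) :=
    hasL2Majorant_mono (g := toB6 (geo9Y x) (0 : ℝ) True) _ (hRd 0 (Sum.inl 0) (Sum.inl 0)) fun p q => le_of_eq (by rw [hK]; rfl)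
  have h1 : ∀ k, HasL2Majorant (g := toB6 (geo9Y x) (0 : ℝ) True) (fun p : SiteY x.toKIdx × ι => blkC x.toKIdx ιB p.1) (conj b (DU k) * conj b Gw)
      (fun p q => Bin * (geo9Y x).len p * Real.exp (-(δ₀ * (geo9Y x).dist p q))) := fun k => by
    have h : HasL2Majorant (g := toB6 (geo9Y x) (0 : ℝ) True) (fun p : SiteY x.toKIdx × ι => blkC x.toKIdx ιB p.1) (conj b (DU k * Gw))
        (fun p q => (Real.sqrt (Fintype.card ι) * M₂ * ∑ j, ‖b j‖) * B₀ * B9.pref6 ((geo9Y x).len p) 1 * Real.exp (-(δ₀ * (geo9Y x).dist p q))) :=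
      hRd 1 k k
    rw [B9Eq352DivFormLetters.conj_mul] at h
    exact hasL2Majorant_mono (g := toB6 (geo9Y x) (0 : ℝ) True) _ h fun p q => le_of_eq (by rw [hK]; rfl)
  have h2 : ∀ k, HasL2Majorant (g := toB6 (geo9Y x) (0 : ℝ) True) (fun p : SiteY x.toKIdx × ι => blkC x.toKIdx ιB p.1) (conj b Gw * conj b (DU k))
      (fun p q => Bin * (geo9Y x).len p * Real.exp (-(δ₀ * (geo9Y x).dist p q))) := fun k => by
    have h : HasL2Majorant (g := toB6 (geo9Y x) (0 : ℝ) True) (fun p : SiteY x.toKIdx × ι => blkC x.toKIdx ιB p.1) (conj b (Gw * DU k))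
        (fun p q => (Real.sqrt (Fintype.card ι) * M₂ * ∑ j, ‖b j‖) * B₀ * B9.pref6 ((geo9Y x).len p) 2 * Real.exp (-(δ₀ * (geo9Y x).dist p q))) :=
      hRd 2 k k
    rw [B9Eq352DivFormLetters.conj_mul] at h
    exact hasL2Majorant_mono (g := toB6 (geo9Y x) (0 : ℝ) True) _ h fun p q => le_of_eq (by rw [hK]; rfl)
  have h4 : ∀ k l, HasL2Majorant (g := toB6 (geo9Y x) (0 : ℝ) True) (fun p : SiteY x.toKIdx × ι => blkC x.toKIdx ιB p.1)
      (conj b (DU k) * conj b Gw * conj b (DU l)) (fun p q => Bin * 1 * Real.exp (-(δ₀ * (geo9Y x).dist p q))) := fun k l => by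
    have h : HasL2Majorant (g := toB6 (geo9Y x) (0 : ℝ) True) (fun p : SiteY x.toKIdx × ι => blkC x.toKIdx ιB p.1) (conj b (DU k * Gw * DU l))
        (fun p q => (Real.sqrt (Fintype.card ι) * M₂ * ∑ j, ‖b j‖) * B₀ * B9.pref6 ((geo9Y x).len p) 4 * Real.exp (-(δ₀ * (geo9Y x).dist p q))) :=
      hRd 4 k l
    rw [B9Eq352DivFormLetters.conj_mul, B9Eq352DivFormLetters.conj_mul] at h
    exact hasL2Majorant_mono (g := toB6 (geo9Y x) (0 : ℝ) True) _ h fun p q => le_of_eq (by rw [hK]; rfl)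
  -- rates
  have hρ₁0 : 0 ≤ ρ₁ := by rw [hρ₁]; positivity
  have hρ₂0 : 0 ≤ ρ₂ := by rw [hρ₂]; positivity
  have hr₁ : ρ₁ + (1 / 12 + 1 / 12) * δ₀ ≤ δ₀ := by rw [hρ₁]; linarith
  have hρ₁δ : ρ₁ ≤ δ₀ := by rw [hρ₁]; linarith
  have hr₂ : ρ₂ + (1 / 12 + 1 / 12) * δ₀ ≤ ρ₁ := by rw [hρ₁, hρ₂]; linarith
  have hρ₂₁ : ρ₂ ≤ ρ₁ := by rw [hρ₁, hρ₂]; linarith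
  have hhalf₁ : δ₀ / 2 ≤ ρ₁ := by rw [hρ₁]; linarith
  have hhalf₂ : δ₀ / 2 ≤ ρ₂ := by rw [hρ₂]; linarith
  have hwℓ : ∀ p : (geo9Y x).Site, 0 ≤ (geo9Y x).len p := fun p => (hlen p).le
  have hwℓ2 : ∀ p : (geo9Y x).Site, 0 ≤ (geo9Y x).len p ^ 2 := fun p => sq_nonneg _
  have hw21 : ∀ p : (geo9Y x).Site, ((geo9Y x).len p)⁻¹ * (geo9Y x).len p ^ 2 ≤ (geo9Y x).len p := fun p =>
    le_of_eq (by rw [pow_two, ← mul_assoc, inv_mul_cancel₀ (hlen p).ne', one_mul])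
  have hw21' : ∀ p : (geo9Y x).Site, (geo9Y x).len p ^ 2 * ((geo9Y x).len p)⁻¹ ≤ (geo9Y x).len p := fun p =>
    le_of_eq (by rw [pow_two, mul_assoc, mul_inv_cancel₀ (hlen p).ne', mul_one])
  have hw10 : ∀ p : (geo9Y x).Site, ((geo9Y x).len p)⁻¹ * (geo9Y x).len p ≤ 1 := fun p => le_of_eq (inv_mul_cancel₀ (hlen p).ne')
  have hw10' : ∀ p : (geo9Y x).Site, (geo9Y x).len p * ((geo9Y x).len p)⁻¹ ≤ 1 := fun p => le_of_eq (mul_inv_cancel₀ (hlen p).ne')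
  have hcDef : ∀ r : ℝ, 4 * (1 : ℝ) ^ 2 * M₂ * (∑ j, ‖b j‖) * Real.sqrt (Fintype.card ι) * Real.exp (r * d₀) = cDef M₂ Sb sι d r := fun r => by
    rw [cDef, hSbdef, hsι, hd₀]
  -- CONVERT, left (member 1): `∇♯_{W,k}·Gw`, rate ρ₁, constant g₀·Bin
  have hLeft : ∀ k, HasL2Majorant (g := toB6 (geo9Y x) (0 : ℝ) True) (fun p : SiteY x.toKIdx × ι => blkC x.toKIdx ιB p.1)
      (conj b (diffLetter (shiftY x.toKIdx) (UboxY x.toKIdx W) (((η : ℂ))⁻¹) k) * conj b Gw)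
      (fun p q => (g₀ * Bin) * (geo9Y x).len p * Real.exp (-(ρ₁ * (geo9Y x).dist p q))) := fun k => by
    rw [hUW]
    have h := hasL2Majorant_diffLetter_prodCfg_mul b (shiftY x.toKIdx) (UboxY x.toKIdx U) (Rr := (0 : ℝ)) (H := True) (g := geo9Y x)
      (fun z => blkC x.toKIdx ιB z) dL hη0 (chartA x.toKIdx a) 1 d₀ M₂ (1 / 4) δ₀ δ₀ (1 / 12) (1 / 12) ρ₁ Λ Bin
      (fun p => (geo9Y x).len p ^ 2) (fun p => (geo9Y x).len p) hwℓ2 hwℓ hw21 (by norm_num) hδ₀.le hM₂ hBin0 hΛ hρ₁0 hr₁ hρ₁δ hrepr hdnn htri hlen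
      h261 hT2 hsmall hA hρu hd₀F k (Gp := conj b Gw) h0 (h1 k)
    refine hasL2Majorant_mono (g := toB6 (geo9Y x) (0 : ℝ) True) _ h fun p q => le_of_eq ?_
    rw [hcDef, hg₀]
  -- CONVERT, right (member 2): `Gw·∇♯_{W,k}`, rate ρ₁, constant g₁·Bin
  have hRight : ∀ k, HasL2Majorant (g := toB6 (geo9Y x) (0 : ℝ) True) (fun p : SiteY x.toKIdx × ι => blkC x.toKIdx ιB p.1)
      (conj b Gw * conj b (diffLetter (shiftY x.toKIdx) (UboxY x.toKIdx W) (((η : ℂ))⁻¹) k))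
      (fun p q => (g₁ * Bin) * (geo9Y x).len p * Real.exp (-(ρ₁ * (geo9Y x).dist p q))) := fun k => by
    rw [hUW]
    have h := hasL2Majorant_mul_diffLetter_prodCfg b (shiftY x.toKIdx) (UboxY x.toKIdx U) (Rr := (0 : ℝ)) (H := True) (g := geo9Y x)
      (fun z => blkC x.toKIdx ιB z) dL hη0 (chartA x.toKIdx a) 1 d₀ M₂ (1 / 4) δ₀ δ₀ (1 / 12) (1 / 12) ρ₁ Λ Bin
      (fun p => (geo9Y x).len p ^ 2) (fun p => (geo9Y x).len p) hwℓ2 hwℓ hw21' (by norm_num) hM₂ hBin0 hΛ hρ₁0 hr₁ hρ₁δ hrepr hdnn htri hlen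
      h261 hTi hsmall hA hρu hd₀F k (Gp := conj b Gw) h0 (h2 k)
    refine hasL2Majorant_mono (g := toB6 (geo9Y x) (0 : ℝ) True) _ h fun p q => le_of_eq ?_
    rw [hcDef, hg₁]
  -- CONVERT, mixed, step B: `(∇♯_{U,k}·Gw)·∇♯_{W,l}`, rate ρ₁, constant g₁·Bin
  have hStepB : ∀ k l, HasL2Majorant (g := toB6 (geo9Y x) (0 : ℝ) True) (fun p : SiteY x.toKIdx × ι => blkC x.toKIdx ιB p.1)
      (conj b (DU k) * conj b Gw * conj b (diffLetter (shiftY x.toKIdx) (UboxY x.toKIdx W) (((η : ℂ))⁻¹) l))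
      (fun p q => (g₁ * Bin) * 1 * Real.exp (-(ρ₁ * (geo9Y x).dist p q))) := fun k l => by
    rw [hUW]
    have h := hasL2Majorant_mul_diffLetter_prodCfg b (shiftY x.toKIdx) (UboxY x.toKIdx U) (Rr := (0 : ℝ)) (H := True) (g := geo9Y x)
      (fun z => blkC x.toKIdx ιB z) dL hη0 (chartA x.toKIdx a) 1 d₀ M₂ (1 / 4) δ₀ δ₀ (1 / 12) (1 / 12) ρ₁ Λ Bin
      (fun p => (geo9Y x).len p) (fun _ => (1 : ℝ)) hwℓ (fun _ => zero_le_one) hw10' (by norm_num) hM₂ hBin0 hΛ hρ₁0 hr₁ hρ₁δ hrepr hdnn htri hlen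
      h261 hTi hsmall hA hρu hd₀F l (Gp := conj b (DU k) * conj b Gw) (h1 k) (h4 k l)
    refine hasL2Majorant_mono (g := toB6 (geo9Y x) (0 : ℝ) True) _ h fun p q => le_of_eq ?_
    rw [hcDef, hg₁]
  -- CONVERT, mixed, step C: LEFT on `Gp′ := Gw·∇♯_{W,l}` (weight ℓ, rate ρ₁, step A = hRight) with left entries from step B, rate ρ₂
  have hMixed : ∀ k l, HasL2Majorant (g := toB6 (geo9Y x) (0 : ℝ) True) (fun p : SiteY x.toKIdx × ι => blkC x.toKIdx ιB p.1)
      (conj b (diffLetter (shiftY x.toKIdx) (UboxY x.toKIdx W) (((η : ℂ))⁻¹) k) * conj b Gw *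
        conj b (diffLetter (shiftY x.toKIdx) (UboxY x.toKIdx W) (((η : ℂ))⁻¹) l))
      (fun p q => (g₁ * (g₁ * Bin)) * 1 * Real.exp (-(ρ₂ * (geo9Y x).dist p q))) := fun k l => by
    have hGp' := hRight l
    have hDGp' : HasL2Majorant (g := toB6 (geo9Y x) (0 : ℝ) True) (fun p : SiteY x.toKIdx × ι => blkC x.toKIdx ιB p.1)
        (conj b (DU k) * (conj b Gw * conj b (diffLetter (shiftY x.toKIdx) (UboxY x.toKIdx W) (((η : ℂ))⁻¹) l)))
        (fun p q => (g₁ * Bin) * 1 * Real.exp (-(ρ₁ * (geo9Y x).dist p q))) := by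
      rw [← mul_assoc]; exact hStepB k l
    rw [mul_assoc, hUW]
    rw [hUW] at hGp' hDGp'
    have h := hasL2Majorant_diffLetter_prodCfg_mul b (shiftY x.toKIdx) (UboxY x.toKIdx U) (Rr := (0 : ℝ)) (H := True) (g := geo9Y x)
      (fun z => blkC x.toKIdx ιB z) dL hη0 (chartA x.toKIdx a) 1 d₀ M₂ (1 / 4) δ₀ ρ₁ (1 / 12) (1 / 12) ρ₂ Λ (g₁ * Bin)
      (fun p => (geo9Y x).len p) (fun _ => (1 : ℝ)) hwℓ (fun _ => zero_le_one) hw10 (by norm_num) hρ₁0 hM₂ (mul_nonneg hg₁0 hBin0) hΛ hρ₂0 hr₂ hρ₂₁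
      hrepr hdnn htri hlen h261 hT1 hsmall hA hρu hd₀F k
      (Gp := conj b Gw * conj b (diffLetter (shiftY x.toKIdx) (prodCfg (UboxY x.toKIdx U) η (chartA x.toKIdx a)) (((η : ℂ))⁻¹) l)) hGp' hDGp'
    refine hasL2Majorant_mono (g := toB6 (geo9Y x) (0 : ℝ) True) _ h fun p q => le_of_eq ?_
    rw [hcDef, hg₁]
  -- the common constant `Bc = g₀·g₁·Bin` and the common rate `δ₀/2`
  have hBc0 : 0 ≤ Bc := by rw [hBc]; exact mul_nonneg (mul_nonneg hg₀0 hg₁0) hBin0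
  have hleBin : Bin ≤ Bc := by rw [hBc]; exact le_mul_of_one_le_left hBin0 (one_le_mul_of_one_le_of_one_le hg₀1 hg₁1)
  have hleL : g₀ * Bin ≤ Bc := by rw [hBc]; exact mul_le_mul_of_nonneg_right (le_mul_of_one_le_right hg₀0 hg₁1) hBin0
  have hleR : g₁ * Bin ≤ Bc := by rw [hBc]; exact mul_le_mul_of_nonneg_right (le_mul_of_one_le_left hg₁0 hg₀1) hBin0
  have hleM : g₁ * (g₁ * Bin) ≤ Bc := by
    rw [hBc, ← mul_assoc]
    -- g₁ ≤ g₀ since cDef is monotone in the rate and ρ₁ ≤ δ₀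
    have hg : g₁ ≤ g₀ := by
      rw [hg₀, hg₁]
      have hcd : cDef M₂ Sb sι d ρ₁ ≤ cDef M₂ Sb sι d δ₀ := by
        unfold cDef
        have hd₀0 : 0 ≤ (2 * ((d : ℝ) + 1)) := by positivity
        exact mul_le_mul_of_nonneg_left (Real.exp_le_exp.2 (mul_le_mul_of_nonneg_right hρ₁δ hd₀0)) (by positivity)
      exact add_le_add_right (mul_le_mul_of_nonneg_right (mul_le_mul_of_nonneg_right (mul_le_mul_of_nonneg_right hcd (by norm_num : (0 : ℝ) ≤ 1 / 4)) hΛ) hc₁0) 1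
    exact mul_le_mul_of_nonneg_right (mul_le_mul_of_nonneg_right hg hg₁0) hBin0
  have mono : ∀ {T : Module.End ℝ (SiteY x.toKIdx × ι → ℝ)} {B r : ℝ} (w : (geo9Y x).Site → ℝ), (∀ p, 0 ≤ w p) → 0 ≤ B → B ≤ Bc → δ₀ / 2 ≤ r →
      HasL2Majorant (g := toB6 (geo9Y x) (0 : ℝ) True) (fun p : SiteY x.toKIdx × ι => blkC x.toKIdx ιB p.1) T
        (fun p q => B * w p * Real.exp (-(r * (geo9Y x).dist p q))) →
      HasL2Majorant (g := toB6 (geo9Y x) (0 : ℝ) True) (fun p : SiteY x.toKIdx × ι => blkC x.toKIdx ιB p.1) T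
        (fun p q => Bc * w p * Real.exp (-(δ₀ / 2 * (geo9Y x).dist p q))) := by
    intro T B r w hw hB hBBc hr h
    have h' := hasL2Majorant_rate_mono (R := (0 : ℝ)) (H := True) (g := geo9Y x) _ B w hB hw hr hdnn h
    exact hasL2Majorant_mono (g := toB6 (geo9Y x) (0 : ℝ) True) _ h' fun p q =>
      mul_le_mul_of_nonneg_right (mul_le_mul_of_nonneg_right hBBc (hw p)) (Real.exp_nonneg _)
  refine ⟨mono (fun p => (geo9Y x).len p ^ 2) hwℓ2 hBin0 hleBin (by linarith) h0,
    fun k => mono (fun p => (geo9Y x).len p) hwℓ (mul_nonneg hg₀0 hBin0) hleL hhalf₁ (hLeft k),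
    fun k => mono (fun p => (geo9Y x).len p) hwℓ (mul_nonneg hg₁0 hBin0) hleR hhalf₁ (hRight k),
    fun k l => mono (fun _ => (1 : ℝ)) (fun _ => zero_le_one) (mul_nonneg hg₁0 (mul_nonneg hg₁0 hBin0)) hleM hhalf₂ (hMixed k l)⟩

end Member

/-! ## §3 ★★ The record's (3.46) block at `W`, the two same-side second-difference members displayed -/

section Assembly

variable (G : Subgroup 𝔸ˣ) (x : MemberY d ℓ hd hL b₀ b₁ Mstar) (par : SiteParY 𝔸 x.toKIdx) {ι : Type} [Fintype ι] [DecidableEq ι]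
  (b : Module.Basis ι ℝ 𝔸) (ιB : BlkY x.toKIdx → IBondY x.toKIdx) [Fintype (geo9Y x).Site] [DecidableEq (geo9Y x).Site]
  (C37 C38 : ℝ → CfgY 𝔸 x.toKIdx → AfldY 𝔸 x.toKIdx → Prop)

/-- ★★ **THE RECORD'S (3.46) BLOCK AT `W = e^{ηa}·U` FROM THE `KSC₃` BLOCK AT THE PRODUCT — the `L²` `hconv` of the coded-carrier chain, WITH THE TWO SAME-SIDE
SECOND-DIFFERENCE MEMBERS DISPLAYED**: under the data of `hconvL2_words_at`, given ALSO block-`ℓ²` majorants `B_H·e^{−(δ₀/2)d}` of the `W`-words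
`∇♯_{W,k}∇♯_{W,l}·η²G′(W)` and `η²G′(W)·∇♯_{W,k}∇♯_{W,l}` (print's 4th and 6th quantities AT `W` — LOCATED: their conversion from the `U`-letters needs the
plaquette of the (3.35)-regular base — print p. 404 after (3.69), not yet typed), NODE 00's reading `kernelFamilyS … id (GpY par) par` satisfies its (3.46) block at `W` with constant
`c_L·max(B_c, B_H)` and rate `δ₀/2`. [cite: Balaban1985BackgroundPropagators, Thm 3.4 p.400, p.403 l.1–9, Thm 3.1 (3.46) p.398, (3.70) p.404, p.404 (after (3.69)), (3.74) p.405; Balaban1984PropagatorsII, Prop. 2.6 (2.140)–(2.141) p.247, Lemma 2.1 p.234] -/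
theorem l2Block_record_at_W_of_KSC₃ (hι : ∀ s : BlkY x.toKIdx, β x.toKIdx.hN x.toKIdx.D x.toKIdx.hk (ιB s) = s)
    (hG1 : ∀ u : 𝔸ˣ, u ∈ G → ‖(u : 𝔸)‖ ≤ 1) {M₂ : ℝ} (hM₂ : 0 ≤ M₂) (hrepr : ∀ (v : 𝔸) (j : ι), |b.repr v j| ≤ M₂ * ‖v‖)
    {Cq : ℝ} (hC37 : ∀ β' U a, C37 β' U a → GVal G x.toKIdx U ∧ CplxLettersY G x par ιB Cq β' U a)
    {δ₀ : ℝ} (hδ₀ : 0 < δ₀) {dL : ℕ} (h261 : Ineq261 dL (toB6 (geo9Y x) (0 : ℝ) True) δ₀ (1 / 12)) {Λ : ℝ} (hΛ : 0 ≤ Λ)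
    (hT1 : ScaleTransfer (geo9Y x) δ₀ (1 / 12) Λ (fun a => (geo9Y x).len a))
    (hT2 : ScaleTransfer (geo9Y x) δ₀ (1 / 12) Λ (fun a => (geo9Y x).len a ^ 2))
    (hTi : ScaleTransfer (geo9Y x) δ₀ (1 / 12) Λ (fun a => ((geo9Y x).len a)⁻¹))
    {B₀ : ℝ} (hB₀ : 0 ≤ B₀) {U : CfgY 𝔸 x.toKIdx} {a : AfldY 𝔸 x.toKIdx} {α₁ : ℝ} (hα₁c : α₁ ≤ 1 / 4) (hC : C37 α₁ U a)
    (hL2 : L2Block (KSC₃ G x par C37 C38) B₀ δ₀ (.prod U a)) {BH : ℝ} (hBH : 0 ≤ BH)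
    (hLL : ∀ k l : Fin (d + 1) ⊕ Fin (d + 1), HasL2Majorant (g := toB6 (geo9Y x) (0 : ℝ) True) (fun p : SiteY x.toKIdx × ι => blkC x.toKIdx ιB p.1)
      (conj b (diffLetter (shiftY x.toKIdx) (UboxY x.toKIdx (mulY x.toKIdx (fluct (kGeo x.toKIdx).eta a) U)) ((((kGeo x.toKIdx).eta : ℂ))⁻¹) k) *
        conj b (diffLetter (shiftY x.toKIdx) (UboxY x.toKIdx (mulY x.toKIdx (fluct (kGeo x.toKIdx).eta a) U)) ((((kGeo x.toKIdx).eta : ℂ))⁻¹) l) *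
        conj b (((kGeo x.toKIdx).eta ^ 2) • (GpY x.toKIdx par (mulY x.toKIdx (fluct (kGeo x.toKIdx).eta a) U)).restrictScalars ℝ))
      (fun p q => BH * 1 * Real.exp (-(δ₀ / 2 * (geo9Y x).dist p q))))
    (hRR : ∀ k l : Fin (d + 1) ⊕ Fin (d + 1), HasL2Majorant (g := toB6 (geo9Y x) (0 : ℝ) True) (fun p : SiteY x.toKIdx × ι => blkC x.toKIdx ιB p.1)
      (conj b (((kGeo x.toKIdx).eta ^ 2) • (GpY x.toKIdx par (mulY x.toKIdx (fluct (kGeo x.toKIdx).eta a) U)).restrictScalars ℝ) *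
        conj b (diffLetter (shiftY x.toKIdx) (UboxY x.toKIdx (mulY x.toKIdx (fluct (kGeo x.toKIdx).eta a) U)) ((((kGeo x.toKIdx).eta : ℂ))⁻¹) k) *
        conj b (diffLetter (shiftY x.toKIdx) (UboxY x.toKIdx (mulY x.toKIdx (fluct (kGeo x.toKIdx).eta a) U)) ((((kGeo x.toKIdx).eta : ℂ))⁻¹) l))
      (fun p q => BH * 1 * Real.exp (-(δ₀ / 2 * (geo9Y x).dist p q)))) :
    L2Block (kernelFamilyS x.toKIdx (bg9Y 𝔸 G x) (fun U => U) (GpY x.toKIdx par) par)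
      ((Real.sqrt (Fintype.card ι) * M₂ * ∑ j, ‖b j‖) * max (convConstL2 M₂ (∑ j, ‖b j‖) (Real.sqrt (Fintype.card ι)) d dL δ₀ Λ B₀) BH) (δ₀ / 2)
      (mulY x.toKIdx (fluct (kGeo x.toKIdx).eta a) U) := by
  obtain ⟨h0, h1, h2, h4⟩ := hconvL2_words_at G x par b ιB C37 C38 hι hG1 hM₂ hrepr hC37 hδ₀ h261 hΛ hT1 hT2 hTi hB₀ hα₁c hC hL2
  set η : ℝ := (kGeo x.toKIdx).eta with hηdef
  set W : CfgY 𝔸 x.toKIdx := mulY x.toKIdx (fluct η a) U with hW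
  set Bc : ℝ := convConstL2 M₂ (∑ j, ‖b j‖) (Real.sqrt (Fintype.card ι)) d dL δ₀ Λ B₀ with hBcdef
  set Gw : Module.End ℝ (SiteY x.toKIdx → 𝔸) := (η ^ 2) • (GpY x.toKIdx par W).restrictScalars ℝ with hGw
  set DW : Fin (d + 1) ⊕ Fin (d + 1) → Module.End ℝ (SiteY x.toKIdx → 𝔸) := fun k => diffLetter (shiftY x.toKIdx) (UboxY x.toKIdx W) (((η : ℂ))⁻¹) k
    with hDW
  have hlen : ∀ y : (geo9Y x).Site, 0 < (geo9Y x).len y := geo9Y_len_pos x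
  have hm0 : 0 ≤ max Bc BH := le_max_of_le_right hBH
  -- the constants up to the common `max Bc BH`, the weights to `pref6`
  have mono : ∀ {T : Module.End ℝ (SiteY x.toKIdx × ι → ℝ)} {B : ℝ} (n : Fin 6) (w : (geo9Y x).Site → ℝ), (∀ p, 0 ≤ w p) → B ≤ max Bc BH →
      (∀ p, w p = B9.pref6 ((geo9Y x).len p) n) →
      HasL2Majorant (g := toB6 (geo9Y x) (0 : ℝ) True) (fun p : SiteY x.toKIdx × ι => blkC x.toKIdx ιB p.1) T
        (fun p q => B * w p * Real.exp (-(δ₀ / 2 * (geo9Y x).dist p q))) →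
      HasL2Majorant (g := toB6 (geo9Y x) (0 : ℝ) True) (fun p : SiteY x.toKIdx × ι => blkC x.toKIdx ιB p.1) T
        (fun p q => max Bc BH * B9.pref6 ((geo9Y x).len p) n * Real.exp (-(δ₀ / 2 * (geo9Y x).dist p q))) := by
    intro T B n w hw hB hwn h
    exact hasL2Majorant_mono (g := toB6 (geo9Y x) (0 : ℝ) True) _ h fun p q => by
      rw [← hwn p]; exact mul_le_mul_of_nonneg_right (mul_le_mul_of_nonneg_right hB (hw p)) (Real.exp_nonneg _)
  refine l2Block_kernelFamilyS_of_hasL2Majorant_wordL x ιB b hι hM₂ hrepr (0 : ℝ) True (B := bg9Y 𝔸 G x) (fun U => U) (GpY x.toKIdx par) par hm0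
    (c := W) fun n k l => ?_
  match n with
  | 0 => exact mono 0 (fun p => (geo9Y x).len p ^ 2) (fun p => sq_nonneg _) (le_max_left _ _) (fun p => rfl) h0
  | 1 =>
    have h := h1 k
    rw [← B9Eq352DivFormLetters.conj_mul] at h
    exact mono 1 (fun p => (geo9Y x).len p) (fun p => (hlen p).le) (le_max_left _ _) (fun p => rfl) h
  | 2 =>
    have h := h2 k
    rw [← B9Eq352DivFormLetters.conj_mul] at h
    exact mono 2 (fun p => (geo9Y x).len p) (fun p => (hlen p).le) (le_max_left _ _) (fun p => rfl) h
  | 3 =>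
    have h := hLL k l
    rw [← B9Eq352DivFormLetters.conj_mul, ← B9Eq352DivFormLetters.conj_mul] at h
    exact mono 3 (fun _ => (1 : ℝ)) (fun _ => zero_le_one) (le_max_right _ _) (fun p => rfl) h
  | 4 =>
    have h := h4 k l
    rw [← B9Eq352DivFormLetters.conj_mul, ← B9Eq352DivFormLetters.conj_mul] at h
    exact mono 4 (fun _ => (1 : ℝ)) (fun _ => zero_le_one) (le_max_left _ _) (fun p => rfl) h
  | 5 =>
    have h := hRR k l
    rw [← B9Eq352DivFormLetters.conj_mul, ← B9Eq352DivFormLetters.conj_mul] at h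
    exact mono 5 (fun _ => (1 : ℝ)) (fun _ => zero_le_one) (le_max_right _ _) (fun p => rfl) h

end Assembly

end Literature.MathematicalPhysics.QuantumFieldTheory.Balaban1983to89.B9SectBL2TransferConvY

end
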